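import Literature.Computability.Complexity.CircuitRestriction
import HarnessLib

/-!
# Renaming the input variables of a straight-line circuit (projection closure with depth)

Infrastructure for the circuits of `Literature.Computability.Complexity.Circuit`: the circuit
`C.mapInputs e` over variables `κ` obtained from `C : Circuit ι` by renaming every input wire `i`
to `e i` along `e : ι → κ` computes `u ↦ C (u ∘ e)` with the SAME gates — same size, same basis,
same (weighted) depth. Together with constant hard-wiring (`Circuit.exists_restrict`,
`CircuitRestriction.lean`) this is the closure of depth-`d` size-`s` circuit classes under
*projections* (substituting variables and constants for variables), as used in averaging /
restriction arguments (e.g. Aaronson–Chen 2017, proof of Lemma 5.5: "Setting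
`x_{(i-1)N+y_i} = z_i` for each `i`, and all other inputs to `0` in the circuit `C`, we then have a
circuit `D` of size at most `S` and depth at most `d - 1` over `{0,1}^N`"). The size-only form of
renaming is `CktSize.rewire` (`CircuitComposition.lean`), whose gate-list relocation calculus
(`GateList.reloc`, `vals_append_reloc`, `wireOf_shiftWire`) is reused; the depth bookkeeping uses
`GateList.wdepths` (`CircuitRestriction.lean`). Everything here is proved.

## References

* H. Vollmer, *Introduction to Circuit Complexity* (1999), §1.2 (projections) [Vollmer1999].
* S. Aaronson, L. Chen, CCC 2017, arXiv:1612.05903, proof of Lemma 5.5 (p. 24) [AaronsonChen2017].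
-/

namespace Literature.Computability.Complexity

open Finset GateList

variable {ι κ : Type*}

namespace GateList

/-- Relocating a program behind the EMPTY program along input wires `i ↦ inl (e i)` (pure
renaming of inputs) does not change the weighted depths of its gates. [folklore] -/
theorem wdepths_map_reloc_inl (w : GateFn → ℕ) (e : ι → κ) (gs : List (Gate ι)) :
    wdepths w (gs.map (reloc (fun i => Sum.inl (e i)) 0)) = wdepths w gs := by
  induction gs using List.reverseRecOn with
  | nil => rfl
  | append_singleton gs g ih =>
    rw [List.map_append, List.map_singleton, wdepths_append_singleton, wdepths_append_singleton,
      ih, reloc_fn]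
    congr 3
    refine Finset.sup_congr rfl fun a _ => ?_
    show wireDepthOf (wdepths w gs) (shiftWire (fun i => Sum.inl (e i)) 0 (g.args a)) =
      wireDepthOf (wdepths w gs) (g.args a)
    cases g.args a with
    | inl i => rfl
    | inr m => simp [shiftWire]

/-- Renaming inputs does not change the depth of a wire. [folklore] -/
theorem wireDepthOf_shiftWire_inl (ds : List ℕ) (e : ι → κ) (u : ι ⊕ ℕ) :
    wireDepthOf ds (shiftWire (fun i => Sum.inl (e i)) 0 u) = wireDepthOf ds u := by
  cases u with
  | inl i => rfl
  | inr m => simp [shiftWire]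

end GateList

namespace Circuit

/-- **Renaming the inputs of a circuit**: every input wire `i` of `C` becomes the input wire
`e i`; gates, their order and the output wire are unchanged (Vollmer's projection closure, the
variable-for-variable case). [cite: Vollmer1999, §1.2] -/
def mapInputs (e : ι → κ) (C : Circuit ι) : Circuit κ :=
  toCircuit (C.gates.map (reloc (fun i => Sum.inl (e i)) 0))
    (shiftWire (fun i => Sum.inl (e i)) 0 C.output)
    (by simpa using (WF.nil.append_reloc (wf_gates C) (wiresOK_inl 0 e)))
    (by
      intro m hm
      rw [List.length_map]
      cases hC : C.output with
      | inl i => rw [hC] at hm; cases hm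
      | inr m' =>
        rw [hC] at hm
        simp only [shiftWire, add_zero, Sum.inr.injEq] at hm
        subst hm
        exact C.wf_output m' hC)

/-- The renamed circuit computes `u ↦ C (u ∘ e)`. [cite: Vollmer1999, §1.2] -/
theorem eval_mapInputs (e : ι → κ) (C : Circuit ι) (u : κ → Bool) :
    (C.mapInputs e).eval u = C.eval (fun i => u (e i)) := by
  rw [mapInputs, circuit_eval, circuit_eval]
  have h1 := vals_append_reloc [] C.gates (fun i => (Sum.inl (e i) : κ ⊕ ℕ)) (wiresOK_inl 0 e) u
  simp only [List.nil_append, List.length_nil, vals_nil, wireOf_inl] at h1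
  have h2 := wireOf_shiftWire (L := 0) u [] (vals C.gates fun i => u (e i)) rfl _
    (wiresOK_inl 0 e) C.output
  simp only [List.nil_append, wireOf_inl] at h2
  show wireOf u (vals (C.gates.map (reloc (fun i => Sum.inl (e i)) 0)) u)
      (shiftWire (fun i => Sum.inl (e i)) 0 C.output) = _
  rw [h1, h2]

/-- Renaming inputs keeps the number of gates. [cite: Vollmer1999, §1.2] -/
@[simp] theorem size_mapInputs (e : ι → κ) (C : Circuit ι) : (C.mapInputs e).size = C.size := by
  simp [mapInputs, toCircuit, Circuit.size]

/-- Renaming inputs keeps the basis. [cite: Vollmer1999, §1.2] -/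
theorem IsOver.mapInputs {B : Set GateFn} {C : Circuit ι} (h : C.IsOver B) (e : ι → κ) :
    (C.mapInputs e).IsOver B := by
  intro g hg
  obtain ⟨g', hg', rfl⟩ := List.mem_map.1 hg
  rw [reloc_fn]
  exact h g' hg'

/-- Renaming inputs keeps every weighted depth. [cite: Vollmer1999, §1.2] -/
theorem depthWith_mapInputs (e : ι → κ) (C : Circuit ι) (w : GateFn → ℕ) :
    (C.mapInputs e).depthWith w = C.depthWith w := by
  rw [circuit_depthWith, circuit_depthWith]
  show wireDepthOf (wdepths w (C.gates.map (reloc (fun i => Sum.inl (e i)) 0)))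
      (shiftWire (fun i => Sum.inl (e i)) 0 C.output) = _
  rw [wdepths_map_reloc_inl, wireDepthOf_shiftWire_inl]

/-- Renaming inputs keeps the `AC` depth (negations free). [cite: Vollmer1999, §1.2] -/
@[simp] theorem acDepth_mapInputs (e : ι → κ) (C : Circuit ι) : (C.mapInputs e).acDepth = C.acDepth :=
  depthWith_mapInputs e C acWeight

/-- Renaming inputs keeps the depth. [cite: Vollmer1999, §1.2] -/
@[simp] theorem depth_mapInputs (e : ι → κ) (C : Circuit ι) : (C.mapInputs e).depth = C.depth :=
  depthWith_mapInputs e C _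

/-- **Projection closure of bounded-depth bounded-size `AC` circuits**: for a circuit `C` over
`acBasis` on variables `ι`, a partial assignment `ρ` of its inputs and a renaming `e : ι → κ` of
the free inputs, there is a circuit over `acBasis` on variables `κ`, with at most `max C.size 1`
gates and `acDepth` at most `max C.acDepth 1`, computing `u ↦ C ((u ∘ e)|_ρ)`.
[cite: AaronsonChen2017, proof of Lemma 5.5 (p. 24)] -/
theorem exists_project (C : Circuit ι) (hC : C.IsOver acBasis) (ρ : ι → Option Bool) (e : ι → κ) :
    ∃ D : Circuit κ, D.IsOver acBasis ∧ D.size ≤ max C.size 1 ∧ D.acDepth ≤ max C.acDepth 1 ∧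
      ∀ u : κ → Bool, D.eval u = C.eval (restrictInput ρ fun i => u (e i)) := by
  obtain ⟨C', hB, hs, hd, hev⟩ := C.exists_restrict hC ρ
  refine ⟨C'.mapInputs e, hB.mapInputs e, by simpa using hs, by simpa using hd, fun u => ?_⟩
  rw [eval_mapInputs, hev]

end Circuit

end Literature.Computability.Complexity
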